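import Mathlib
import HarnessLib
import Literature.MathematicalPhysics.StatisticalMechanics.LennardJonesClusters
import Summits.AtomisticToContinuum.Crystallization.Theorems.ContactSaturationLadderWindowFloor
import Summits.AtomisticToContinuum.Crystallization.Theorems.ContactSaturationLadderCrossTermFloor
import Summits.AtomisticToContinuum.Crystallization.Theorems.ContactSaturationLadderWindowCeiling

/-!
# ContactSaturationLadder · `LooseTextureRung` (stmt-AtomisticToContinuum-30303) — the DILATION CHARGE of a sub-window

Helper module for the crux `Summit.AtomisticToContinuum.Crystallization.Theses.ContactSaturationLadder.LooseTextureRung`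
(registered skeleton v6.3 «DialFreeSieveV6», stub `stub_corelessLaw6` = the CORELESS LAW CL
`∃ κ > 0 ∃ C, CorelessLawGS 6 κ C`: coreless loose particles of a ground-state window pay `κ` each, up to `C·ρ²`).
It lands the first rung of the STRAIN-MODE ladder beneath CL (decomp-a2c lens-1 g26; critic row 328 (ii) «e⋆-free coercivity,
dilation-only = one-variable convexity of `A d⁻¹² − B d⁻⁶`»), in its strongest, configuration-free form.

## What is proved (GS-free §1–§3, GS grade §4)

Write, for distinct points `y : Fin N → ℝ³` and ANY index set `W` (ordered pairs inside `W`),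
`S₁₂(W) = Σ_{i∈W} Σ_{k∈W∖{i}} |y_i − y_k|⁻¹²`, `S₆(W) = Σ_{i∈W} Σ_{k∈W∖{i}} |y_i − y_k|⁻⁶`, so that the internal energy is
`𝓔(y|W) = ½ Σ_{i∈W} Σ_{k∈W∖{i}} V_LJ = S₁₂/24 − S₆/12` (`half_sum_lennardJones_eq`) and the half-counted window VIRIAL is
`½ ΣΣ r V_LJ'(r) = −(S₁₂ − S₆)/2`; let `e⋆ = ⨅_Q e(Q)` be the periodic ground-state energy per particle (the crux's currency).

* §1–§2 `card_mul_iInf_le_dilate` — THE DILATION FAMILY OF FLOORS: `#W·e⋆ ≤ u²·S₁₂/24 − u·S₆/12` for EVERY `u > 0`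
  (the tree's periodisation floor `card_mul_iInf_le_half_sum` applied to the dilated configuration `u^{-1/6}·y`, which is again
  a configuration of distinct points — `e⋆` is dilation-invariant, the window energy is not).
* §3 `dilationCharge_le` — THE DILATION CHARGE: optimising `u` (`u = S₆/S₁₂`),
      `(S₁₂(W) − S₆(W))² / (24·S₁₂(W)) ≤ 𝓔(y|W) − #W·e⋆`
  for EVERY sub-window of EVERY configuration: the excess of a window over the bulk floor controls the square of its virial
  («pressure»); equality of the two lattice sums is forced up to the square root of the excess.  `e⋆`-FREE in the sense of the
  critic's ruling: no value, sign or attainment of `e⋆` is used — only its definition as an infimum over periodic states and its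
  scale invariance.  Separated form `virial_sq_le_of_separated`: at separation `δ`, `S₁₂ ≤ 250·δ⁻¹²·#W` (shell sum), hence
      `(S₁₂ − S₆)² ≤ 6000·δ⁻¹²·#W·(𝓔(y|W) − #W·e⋆)`.
* §4 GS GRADE — LOCAL ZERO PRESSURE and MOMENT PINNING on ground-state windows (`gsWindow_excess_virial`,
  `gsWindowVirial_small`, `gsWindowTwelve_pinned`, `gsWindowSix_pinned`): for every `ε > 0` there is `ρ₁` such that for all
  `ρ ≥ ρ₁`, every Lennard-Jones ground state `y` and every centre `p`, the window `B = B(p,ρ)` satisfies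
      `|S₁₂(B) − S₆(B)| ≤ ε·(#B + ρ³)`,  `|S₁₂(B) + 24·#B·e⋆| ≤ ε·(#B + ρ³)`,  `|S₆(B) + 24·#B·e⋆| ≤ ε·(#B + ρ³)`
  — from the charge, the tree's TRIAL-STATE CEILING `ContactSaturationLadderWindowCeiling.gsWindowCeiling` (p797612), the tree's
  CROSS-TERM FLOOR `ContactSaturationLadderCrossTermFloor.stub_crossTermFloor` (p775283), the window split
  `Σ_{i∈B}(𝓔ⁱ/2 − e⋆) = (𝓔(y|B) − #B·e⋆) + X_∂(B)` and the uniform minimal distance of ground states.  So inside large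
  ground-state windows BOTH lattice sums per particle are pinned to `−24·e⋆` at density `o(1) + O(ρ³/#B)`: the window-scale
  DILATATION mode of any putative loose texture carries no freedom — the necessary-side companion of the node's `CorelessNullGS`.

## Why this is the honest first rung and not CL
The charge sees only the window-scale dilatation mode: a self-equilibrated texture (lattice sums balanced window by window, strain
in deviatoric or finer modes) has zero dilation charge, so `dilationCharge_le` ALONE does not price coreless looseness; the affine
(deviatoric) and chart-level rungs are typed in the lens-1 node §36 and remain open.  What the rung buys: every competitor / texture
argument for CL may henceforth assume `S₁₂ = S₆ + O(√(#W·excess))` on every sub-window, and at GS grade `S₁₂, S₆ = −24e⋆·#B + o(#B+ρ³)`.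
-/

namespace Summit.AtomisticToContinuum.Crystallization.Theorems.ContactSaturationLadderDilationCharge

open scoped BigOperators Classical
open Literature.MathematicalPhysics.StatisticalMechanics (lennardJones IsGroundState PeriodicConfiguration siteEnergy
  LennardJonesMinimalDistance_holds sum_inv_pow_six_le)
open Summit.AtomisticToContinuum.Crystallization.Theorems.ContactSaturationLadderWindowFloor (card_mul_iInf_le_half_sum
  siteEnergy_split)

/-! ## §1 Dilations of a configuration -/

/-- The Lennard-Jones potential along a dilation: `V_LJ(t·r) = t⁻¹²·(1/12)·r⁻¹² − t⁻⁶·(1/6)·r⁻⁶`. -/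
theorem lennardJones_mul (t r : ℝ) :
    lennardJones (t * r) = (t⁻¹) ^ 12 * ((1 / 12) * (r⁻¹) ^ 12) - (t⁻¹) ^ 6 * ((1 / 6) * (r⁻¹) ^ 6) := by
  simp only [lennardJones, mul_inv, mul_pow]
  ring

/-- Distances scale under a positive dilation. -/
theorem dist_smul_of_pos {t : ℝ} (ht : 0 < t) (a b : EuclideanSpace ℝ (Fin 3)) :
    dist (t • a) (t • b) = t * dist a b := by
  rw [dist_smul₀, Real.norm_eq_abs, abs_of_pos ht]

/-- A non-zero dilate of a configuration of distinct points consists of distinct points. -/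
theorem injective_smul_of_ne_zero {N : ℕ} {t : ℝ} (ht : t ≠ 0) {y : Fin N → EuclideanSpace ℝ (Fin 3)}
    (hy : Function.Injective y) : Function.Injective fun i => t • y i :=
  (smul_right_injective (EuclideanSpace ℝ (Fin 3)) ht).comp hy

/-- **The window energy along the dilation family.**  For `t > 0`:
`½ Σ_{i∈W} Σ_{k∈W∖{i}} V_LJ(|t y_i − t y_k|) = t⁻¹²·S₁₂(W)/24 − t⁻⁶·S₆(W)/12`. -/
theorem half_sum_lennardJones_dilate {N : ℕ} (y : Fin N → EuclideanSpace ℝ (Fin 3)) (W : Finset (Fin N))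
    {t : ℝ} (ht : 0 < t) :
    (1 / 2) * ∑ i ∈ W, ∑ k ∈ W.erase i, lennardJones (dist (t • y i) (t • y k)) =
      (t⁻¹) ^ 12 * ((∑ i ∈ W, ∑ k ∈ W.erase i, (dist (y i) (y k))⁻¹ ^ 12) / 24) -
        (t⁻¹) ^ 6 * ((∑ i ∈ W, ∑ k ∈ W.erase i, (dist (y i) (y k))⁻¹ ^ 6) / 12) := by
  have h : ∀ i k : Fin N, lennardJones (dist (t • y i) (t • y k)) =
      (t⁻¹) ^ 12 * ((1 / 12) * (dist (y i) (y k))⁻¹ ^ 12) - (t⁻¹) ^ 6 * ((1 / 6) * (dist (y i) (y k))⁻¹ ^ 6) := by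
    intro i k
    rw [dist_smul_of_pos ht, lennardJones_mul]
  simp only [h, Finset.sum_sub_distrib, ← Finset.mul_sum]
  ring

/-- The undilated case: `𝓔(y|W) = ½ ΣΣ V_LJ = S₁₂(W)/24 − S₆(W)/12`. -/
theorem half_sum_lennardJones_eq {N : ℕ} (y : Fin N → EuclideanSpace ℝ (Fin 3)) (W : Finset (Fin N)) :
    (1 / 2) * ∑ i ∈ W, ∑ k ∈ W.erase i, lennardJones (dist (y i) (y k)) =
      (∑ i ∈ W, ∑ k ∈ W.erase i, (dist (y i) (y k))⁻¹ ^ 12) / 24 -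
        (∑ i ∈ W, ∑ k ∈ W.erase i, (dist (y i) (y k))⁻¹ ^ 6) / 12 := by
  have h := half_sum_lennardJones_dilate y W one_pos
  simpa only [one_smul, inv_one, one_pow, one_mul] using h

/-! ## §2 The dilation family of floors -/

/-- **The dilation family of floors.**  For distinct points, every index set `W` and every `u > 0`:
`#W·e⋆ ≤ u²·S₁₂(W)/24 − u·S₆(W)/12` — the periodisation floor `card_mul_iInf_le_half_sum` for the dilate `u^{-1/6}·y`. -/
theorem card_mul_iInf_le_dilate {N : ℕ} {y : Fin N → EuclideanSpace ℝ (Fin 3)} (hy : Function.Injective y)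
    (W : Finset (Fin N)) {u : ℝ} (hu : 0 < u) :
    (W.card : ℝ) * (⨅ Q : PeriodicConfiguration 3, Q.energyPerParticle lennardJones) ≤
      u ^ 2 * ((∑ i ∈ W, ∑ k ∈ W.erase i, (dist (y i) (y k))⁻¹ ^ 12) / 24) -
        u * ((∑ i ∈ W, ∑ k ∈ W.erase i, (dist (y i) (y k))⁻¹ ^ 6) / 12) := by
  -- the dilation factor is `t = s⁻¹` with `s = u^{1/6}`
  set s : ℝ := u ^ ((6 : ℕ) : ℝ)⁻¹ with hs
  have hs0 : 0 < s := by rw [hs]; exact Real.rpow_pos_of_pos hu _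
  have hs6 : s ^ 6 = u := by rw [hs]; exact Real.rpow_inv_natCast_pow hu.le (by norm_num)
  have ht : 0 < s⁻¹ := inv_pos.2 hs0
  have h : (W.card : ℝ) * (⨅ Q : PeriodicConfiguration 3, Q.energyPerParticle lennardJones) ≤
      (1 / 2) * ∑ i ∈ W, ∑ k ∈ W.erase i, lennardJones (dist (s⁻¹ • y i) (s⁻¹ • y k)) :=
    card_mul_iInf_le_half_sum (injective_smul_of_ne_zero ht.ne' hy) W
  rw [half_sum_lennardJones_dilate y W ht, inv_inv] at h
  have h12 : s ^ 12 = u ^ 2 := by rw [← hs6]; ring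
  rwa [h12, hs6] at h

/-! ## §3 The dilation charge -/

/-- The one-variable optimisation behind the charge: if `m ≤ u²·A/24 − u·B/12` for all `u > 0` (`A, B ≥ 0`, and `B = 0 ⇒ A = 0`),
then `(A − B)²/(24A) ≤ A/24 − B/12 − m` (take `u = B/A`; for `A = 0` both sides are as stated with `x/0 = 0`). -/
theorem charge_le_of_dilation_family {A B m : ℝ} (hA : 0 ≤ A) (hB : 0 ≤ B) (hBA : B = 0 → A = 0)
    (h : ∀ u : ℝ, 0 < u → m ≤ u ^ 2 * (A / 24) - u * (B / 12)) :
    (A - B) ^ 2 / (24 * A) ≤ A / 24 - B / 12 - m := by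
  have h1 := h 1 one_pos
  by_cases hA0 : A = 0
  · subst hA0
    have h0 : ((0 : ℝ) - B) ^ 2 / (24 * 0) = 0 := by simp
    rw [h0]
    linarith
  · have hApos : 0 < A := lt_of_le_of_ne hA (Ne.symm hA0)
    have hB0 : B ≠ 0 := fun hB0 => hA0 (hBA hB0)
    have hBpos : 0 < B := lt_of_le_of_ne hB (Ne.symm hB0)
    have hu := h (B / A) (div_pos hBpos hApos)
    have key : (A - B) ^ 2 / (24 * A) = A / 24 - B / 12 + B ^ 2 / (24 * A) := by
      field_simp
      ring
    have h2 : (B / A) ^ 2 * (A / 24) - B / A * (B / 12) = -(B ^ 2 / (24 * A)) := by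
      field_simp
      ring
    rw [key]
    linarith [hu, h2]

/-- The two lattice sums of a window vanish together (term by term `r⁻¹² = (r⁻⁶)²`). -/
theorem sum_inv_pow_eq_zero_iff {N : ℕ} (y : Fin N → EuclideanSpace ℝ (Fin 3)) (W : Finset (Fin N)) {n : ℕ} (hn : n ≠ 0) :
    ∑ i ∈ W, ∑ k ∈ W.erase i, (dist (y i) (y k))⁻¹ ^ n = 0 ↔ ∀ i ∈ W, ∀ k ∈ W.erase i, (dist (y i) (y k))⁻¹ = 0 := by
  rw [Finset.sum_eq_zero_iff_of_nonneg fun i _ => Finset.sum_nonneg fun k _ => by positivity]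
  refine forall₂_congr fun i _ => ?_
  rw [Finset.sum_eq_zero_iff_of_nonneg fun k _ => by positivity]
  refine forall₂_congr fun k _ => ?_
  exact pow_eq_zero_iff hn

/-- **THE DILATION CHARGE** (first rung of the strain-mode ladder beneath the coreless law CL; configuration-free, `e⋆`-free):
for distinct points `y` and EVERY index set `W`,
`(S₁₂(W) − S₆(W))² / (24·S₁₂(W)) ≤ 𝓔(y|W) − #W·e⋆`.
The window excess over the bulk floor dominates the square of the window virial: a sub-window whose two lattice sums differ by
`Δ` pays at least `Δ²/(24·S₁₂)`. -/
theorem dilationCharge_le {N : ℕ} {y : Fin N → EuclideanSpace ℝ (Fin 3)} (hy : Function.Injective y)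
    (W : Finset (Fin N)) :
    ((∑ i ∈ W, ∑ k ∈ W.erase i, (dist (y i) (y k))⁻¹ ^ 12) - ∑ i ∈ W, ∑ k ∈ W.erase i, (dist (y i) (y k))⁻¹ ^ 6) ^ 2 /
        (24 * ∑ i ∈ W, ∑ k ∈ W.erase i, (dist (y i) (y k))⁻¹ ^ 12) ≤
      (1 / 2) * ∑ i ∈ W, ∑ k ∈ W.erase i, lennardJones (dist (y i) (y k)) -
        (W.card : ℝ) * (⨅ Q : PeriodicConfiguration 3, Q.energyPerParticle lennardJones) := by
  rw [half_sum_lennardJones_eq y W]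
  refine charge_le_of_dilation_family (by positivity) (by positivity) (fun h0 => ?_)
    fun u hu => card_mul_iInf_le_dilate hy W hu
  exact (sum_inv_pow_eq_zero_iff y W (by norm_num)).2 ((sum_inv_pow_eq_zero_iff y W (by norm_num)).1 h0)

/-- The window excess is non-negative (the undilated floor, recorded for use below). -/
theorem windowExcess_nonneg {N : ℕ} {y : Fin N → EuclideanSpace ℝ (Fin 3)} (hy : Function.Injective y)
    (W : Finset (Fin N)) :
    0 ≤ (1 / 2) * ∑ i ∈ W, ∑ k ∈ W.erase i, lennardJones (dist (y i) (y k)) -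
        (W.card : ℝ) * (⨅ Q : PeriodicConfiguration 3, Q.energyPerParticle lennardJones) :=
  sub_nonneg.2 (card_mul_iInf_le_half_sum hy W)

/-- **Shell bound for the repulsive lattice sum.**  At separation `δ`: `S₁₂(W) ≤ 250·δ⁻¹²·#W`
(`r⁻¹² ≤ δ⁻⁶·r⁻⁶` termwise and the Literature shell sum `Σ_{k≠i} r⁻⁶ ≤ 250·δ⁻⁶`). -/
theorem sum_inv_pow_twelve_le_of_separated {N : ℕ} (y : Fin N → EuclideanSpace ℝ (Fin 3)) (W : Finset (Fin N))
    {δ : ℝ} (hδ : 0 < δ) (hsep : ∀ k l : Fin N, k ≠ l → δ ≤ dist (y k) (y l)) :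
    ∑ i ∈ W, ∑ k ∈ W.erase i, (dist (y i) (y k))⁻¹ ^ 12 ≤ 250 * δ⁻¹ ^ 12 * (W.card : ℝ) := by
  have hi : ∀ i ∈ W, ∑ k ∈ W.erase i, (dist (y i) (y k))⁻¹ ^ 12 ≤ 250 * δ⁻¹ ^ 12 := by
    intro i _
    calc ∑ k ∈ W.erase i, (dist (y i) (y k))⁻¹ ^ 12
        ≤ ∑ k ∈ Finset.univ.erase i, (dist (y i) (y k))⁻¹ ^ 12 :=
          Finset.sum_le_sum_of_subset_of_nonneg (Finset.erase_subset_erase i (Finset.subset_univ W))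
            fun _ _ _ => by positivity
      _ ≤ ∑ k ∈ Finset.univ.erase i, δ⁻¹ ^ 6 * (dist (y i) (y k))⁻¹ ^ 6 := by
          refine Finset.sum_le_sum fun k hk => ?_
          have hik : i ≠ k := (Finset.ne_of_mem_erase hk).symm
          have hd : δ ≤ dist (y i) (y k) := hsep i k hik
          have hinv : (dist (y i) (y k))⁻¹ ≤ δ⁻¹ := inv_anti₀ hδ hd
          have hinv0 : 0 ≤ (dist (y i) (y k))⁻¹ := by positivity
          calc (dist (y i) (y k))⁻¹ ^ 12 = (dist (y i) (y k))⁻¹ ^ 6 * (dist (y i) (y k))⁻¹ ^ 6 := by ring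
            _ ≤ δ⁻¹ ^ 6 * (dist (y i) (y k))⁻¹ ^ 6 :=
                mul_le_mul_of_nonneg_right (pow_le_pow_left₀ hinv0 hinv 6) (by positivity)
      _ = δ⁻¹ ^ 6 * ∑ k ∈ Finset.univ.erase i, (dist (y i) (y k))⁻¹ ^ 6 := by rw [Finset.mul_sum]
      _ ≤ δ⁻¹ ^ 6 * (250 * δ⁻¹ ^ 6) := mul_le_mul_of_nonneg_left (sum_inv_pow_six_le y hδ hsep i) (by positivity)
      _ = 250 * δ⁻¹ ^ 12 := by ring
  calc ∑ i ∈ W, ∑ k ∈ W.erase i, (dist (y i) (y k))⁻¹ ^ 12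
      ≤ ∑ i ∈ W, 250 * δ⁻¹ ^ 12 := Finset.sum_le_sum hi
    _ = 250 * δ⁻¹ ^ 12 * (W.card : ℝ) := by rw [Finset.sum_const, nsmul_eq_mul]; ring

/-- **Separated form of the charge.**  For `δ`-separated distinct points and every index set `W`:
`(S₁₂(W) − S₆(W))² ≤ 6000·δ⁻¹²·#W·(𝓔(y|W) − #W·e⋆)` — the window virial is at most the geometric mean of the window's
particle number and its excess, up to `√(6000)·δ⁻⁶`. -/
theorem virial_sq_le_of_separated {N : ℕ} {y : Fin N → EuclideanSpace ℝ (Fin 3)} (hy : Function.Injective y)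
    (W : Finset (Fin N)) {δ : ℝ} (hδ : 0 < δ) (hsep : ∀ k l : Fin N, k ≠ l → δ ≤ dist (y k) (y l)) :
    ((∑ i ∈ W, ∑ k ∈ W.erase i, (dist (y i) (y k))⁻¹ ^ 12) - ∑ i ∈ W, ∑ k ∈ W.erase i, (dist (y i) (y k))⁻¹ ^ 6) ^ 2 ≤
      6000 * δ⁻¹ ^ 12 * (W.card : ℝ) *
        ((1 / 2) * ∑ i ∈ W, ∑ k ∈ W.erase i, lennardJones (dist (y i) (y k)) -
          (W.card : ℝ) * (⨅ Q : PeriodicConfiguration 3, Q.energyPerParticle lennardJones)) := by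
  have hc := dilationCharge_le hy W
  have hX := windowExcess_nonneg hy W
  have hS := sum_inv_pow_twelve_le_of_separated y W hδ hsep
  set S : ℝ := ∑ i ∈ W, ∑ k ∈ W.erase i, (dist (y i) (y k))⁻¹ ^ 12 with hSdef
  set T : ℝ := ∑ i ∈ W, ∑ k ∈ W.erase i, (dist (y i) (y k))⁻¹ ^ 6 with hTdef
  set X : ℝ := (1 / 2) * ∑ i ∈ W, ∑ k ∈ W.erase i, lennardJones (dist (y i) (y k)) -
    (W.card : ℝ) * (⨅ Q : PeriodicConfiguration 3, Q.energyPerParticle lennardJones) with hXdef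
  have hS0 : 0 ≤ S := by rw [hSdef]; positivity
  by_cases hS00 : S = 0
  · have hT0 : T = 0 :=
      (sum_inv_pow_eq_zero_iff y W (by norm_num)).2 ((sum_inv_pow_eq_zero_iff y W (by norm_num)).1 hS00)
    have h0 : (S - T) ^ 2 = 0 := by rw [hS00, hT0]; ring
    rw [h0]
    exact mul_nonneg (by positivity) hX
  · have hSpos : 0 < S := lt_of_le_of_ne hS0 (Ne.symm hS00)
    have h24 : (0 : ℝ) < 24 * S := by linarith
    rw [div_le_iff₀ h24] at hc
    calc (S - T) ^ 2 ≤ X * (24 * S) := hc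
      _ ≤ X * (24 * (250 * δ⁻¹ ^ 12 * (W.card : ℝ))) := by
          refine mul_le_mul_of_nonneg_left ?_ hX
          linarith
      _ = 6000 * δ⁻¹ ^ 12 * (W.card : ℝ) * X := by ring

/-! ## §4 GS grade: local zero pressure and moment pinning on ground-state windows -/

/-- The window split: `Σ_{i∈W}(𝓔ⁱ/2 − e) = (𝓔(y|W) − #W·e) + X_∂(W)` (site energies split along `W`). -/
theorem sum_window_split {N : ℕ} (y : Fin N → EuclideanSpace ℝ (Fin 3)) (W : Finset (Fin N)) (e : ℝ) :
    ∑ i ∈ W, (siteEnergy lennardJones y i / 2 - e) =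
      ((1 / 2) * ∑ i ∈ W, ∑ k ∈ W.erase i, lennardJones (dist (y i) (y k)) - (W.card : ℝ) * e) +
        (1 / 2) * ∑ i ∈ W, ∑ k ∈ Finset.univ.filter (fun k : Fin N => k ∉ W), lennardJones (dist (y i) (y k)) := by
  have hsite : ∀ i ∈ W, siteEnergy lennardJones y i / 2 - e =
      ((1 / 2) * ∑ k ∈ W.erase i, lennardJones (dist (y i) (y k)) - e)
        + (1 / 2) * ∑ k ∈ Finset.univ.filter (fun k : Fin N => k ∉ W), lennardJones (dist (y i) (y k)) := by
    intro i hi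
    rw [siteEnergy_split y W hi]
    ring
  rw [Finset.sum_congr rfl hsite, Finset.sum_add_distrib, Finset.sum_sub_distrib, Finset.sum_const, nsmul_eq_mul,
    Finset.mul_sum, Finset.mul_sum]

/-- Real-variable bookkeeping for the pinning corollaries: from `0 ≤ A/24 − B/12 − m ≤ a` and `|A − B| ≤ a`
one gets `|A + 24m| ≤ 26a` and `|B + 24m| ≤ 25a` (`A + 24m = 2(A − B) − 24X`, `B + 24m = (A − B) − 24X`, `X` the excess). -/
theorem pinned_of_excess_virial {A B m a : ℝ} (h0 : 0 ≤ A / 24 - B / 12 - m) (h1 : A / 24 - B / 12 - m ≤ a)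
    (h2 : |A - B| ≤ a) : |A + 24 * m| ≤ 26 * a ∧ |B + 24 * m| ≤ 25 * a := by
  rw [abs_le] at h2
  obtain ⟨h2l, h2r⟩ := h2
  constructor <;> rw [abs_le] <;> constructor <;> linarith

/-- **GS-grade window law (excess ceiling + local zero pressure).**  For every `ε > 0` there is `ρ₁` such that for all
`ρ ≥ ρ₁`, every Lennard-Jones ground state `y` and every centre `p`, the window `B = B(p,ρ)` satisfies
`0 ≤ 𝓔(y|B) − #B·e⋆ ≤ ε·(#B + ρ³)` and `|S₁₂(B) − S₆(B)| ≤ ε·(#B + ρ³)`.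
Inputs: `dilationCharge_le` (this file), `gsWindowCeiling` (tree, p797612), `stub_crossTermFloor` (tree, p775283),
`LennardJonesMinimalDistance_holds` (Literature), `sum_window_split`. -/
theorem gsWindow_excess_virial : ∀ ε : ℝ, 0 < ε → ∃ ρ₁ : ℝ, ∀ ρ : ℝ, ρ₁ ≤ ρ →
    ∀ (N : ℕ) (y : Fin N → EuclideanSpace ℝ (Fin 3)), IsGroundState lennardJones y → ∀ p : EuclideanSpace ℝ (Fin 3),
      0 ≤ (1 / 2) * ∑ i ∈ Finset.univ.filter (fun i : Fin N => dist (y i) p ≤ ρ),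
              ∑ k ∈ (Finset.univ.filter (fun i : Fin N => dist (y i) p ≤ ρ)).erase i, lennardJones (dist (y i) (y k)) -
            ((Finset.univ.filter (fun i : Fin N => dist (y i) p ≤ ρ)).card : ℝ) *
              (⨅ Q : PeriodicConfiguration 3, Q.energyPerParticle lennardJones) ∧
      (1 / 2) * ∑ i ∈ Finset.univ.filter (fun i : Fin N => dist (y i) p ≤ ρ),
              ∑ k ∈ (Finset.univ.filter (fun i : Fin N => dist (y i) p ≤ ρ)).erase i, lennardJones (dist (y i) (y k)) -
            ((Finset.univ.filter (fun i : Fin N => dist (y i) p ≤ ρ)).card : ℝ) *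
              (⨅ Q : PeriodicConfiguration 3, Q.energyPerParticle lennardJones)
          ≤ ε * (((Finset.univ.filter (fun i : Fin N => dist (y i) p ≤ ρ)).card : ℝ) + ρ ^ 3) ∧
      |(∑ i ∈ Finset.univ.filter (fun i : Fin N => dist (y i) p ≤ ρ),
            ∑ k ∈ (Finset.univ.filter (fun i : Fin N => dist (y i) p ≤ ρ)).erase i, (dist (y i) (y k))⁻¹ ^ 12) -
          ∑ i ∈ Finset.univ.filter (fun i : Fin N => dist (y i) p ≤ ρ),
            ∑ k ∈ (Finset.univ.filter (fun i : Fin N => dist (y i) p ≤ ρ)).erase i, (dist (y i) (y k))⁻¹ ^ 6|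
        ≤ ε * (((Finset.univ.filter (fun i : Fin N => dist (y i) p ≤ ρ)).card : ℝ) + ρ ^ 3) := by
  intro ε hε
  -- the uniform minimal distance of ground states and the constant of the separated charge
  obtain ⟨δ, hδ, hsepGS⟩ := LennardJonesMinimalDistance_holds
  obtain ⟨K, hK⟩ : ∃ K : ℝ, K = 6000 * δ⁻¹ ^ 12 := ⟨_, rfl⟩
  have hK0 : 0 < K := by rw [hK]; positivity
  -- the auxiliary accuracy `ε'` fed to the ceiling: `ε' ≤ ε/2` and `2·K·ε' ≤ ε²`
  obtain ⟨ε', hε'⟩ : ∃ ε' : ℝ, ε' = min (ε / 2) (ε ^ 2 / (2 * K)) := ⟨_, rfl⟩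
  have hε'0 : 0 < ε' := by
    rw [hε']
    exact lt_min (by linarith) (div_pos (pow_pos hε 2) (by linarith))
  have hε'1 : ε' ≤ ε / 2 := by rw [hε']; exact min_le_left _ _
  have hε'2 : ε' ≤ ε ^ 2 / (2 * K) := by rw [hε']; exact min_le_right _ _
  have hε'K : 2 * K * ε' ≤ ε ^ 2 := by
    have := (le_div_iff₀ (by linarith : (0 : ℝ) < 2 * K)).1 hε'2
    linarith
  obtain ⟨ρc, hceil⟩ := ContactSaturationLadderWindowCeiling.gsWindowCeiling ε' hε'0
  obtain ⟨C₂, hcross⟩ := ContactSaturationLadderCrossTermFloor.stub_crossTermFloor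
  refine ⟨max 9 (max ρc (|C₂| / ε')), fun ρ hρ N y hGS p => ?_⟩
  have hρ9 : 9 ≤ ρ := le_trans (le_max_left _ _) hρ
  have hρc : ρc ≤ ρ := le_trans (le_trans (le_max_left _ _) (le_max_right _ _)) hρ
  have hρC : |C₂| / ε' ≤ ρ := le_trans (le_trans (le_max_right _ _) (le_max_right _ _)) hρ
  have hρ0 : 0 < ρ := by linarith
  have hy : Function.Injective y := hGS.1
  have hsep : ∀ k l : Fin N, k ≠ l → δ ≤ dist (y k) (y l) := hsepGS N y hGS
  -- the five inputs, in explicit form: floor, ceiling, cross floor, split, separated charge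
  have hX0 := windowExcess_nonneg hy (Finset.univ.filter fun i : Fin N => dist (y i) p ≤ ρ)
  have h1 := hceil ρ hρc N y hGS p
  have h2 := hcross ρ hρ9 N y hGS p
  have h3 := sum_window_split y (Finset.univ.filter fun i : Fin N => dist (y i) p ≤ ρ)
    (⨅ Q : PeriodicConfiguration 3, Q.energyPerParticle lennardJones)
  have hV := virial_sq_le_of_separated hy (Finset.univ.filter fun i : Fin N => dist (y i) p ≤ ρ) hδ hsep
  -- abbreviations (all hypotheses above are rewritten along)
  set B : Finset (Fin N) := Finset.univ.filter (fun i : Fin N => dist (y i) p ≤ ρ) with hB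
  set e : ℝ := ⨅ Q : PeriodicConfiguration 3, Q.energyPerParticle lennardJones with he
  set X : ℝ := (1 / 2) * ∑ i ∈ B, ∑ k ∈ B.erase i, lennardJones (dist (y i) (y k)) - (B.card : ℝ) * e with hXdef
  set S : ℝ := ∑ i ∈ B, ∑ k ∈ B.erase i, (dist (y i) (y k))⁻¹ ^ 12 with hSdef
  set T : ℝ := ∑ i ∈ B, ∑ k ∈ B.erase i, (dist (y i) (y k))⁻¹ ^ 6 with hTdef
  rw [← hK] at hV
  -- (1) ceiling − cross floor ⇒ excess ceiling
  have hC2 : C₂ * ρ ^ 2 ≤ ε' * ρ ^ 3 := by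
    have h' : |C₂| ≤ ε' * ρ := by
      have := (div_le_iff₀ hε'0).1 hρC
      linarith
    have h'' : C₂ ≤ ε' * ρ := le_trans (le_abs_self C₂) h'
    have hρ2 : (0 : ℝ) ≤ ρ ^ 2 := by positivity
    calc C₂ * ρ ^ 2 ≤ (ε' * ρ) * ρ ^ 2 := mul_le_mul_of_nonneg_right h'' hρ2
      _ = ε' * ρ ^ 3 := by ring
  have hX1 : X ≤ 2 * ε' * ((B.card : ℝ) + ρ ^ 3) := by
    have hcard : (0 : ℝ) ≤ ε' * (B.card : ℝ) := by positivity
    linarith [h1, h2, h3, hC2, hXdef]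
  have hM0 : (0 : ℝ) ≤ (B.card : ℝ) + ρ ^ 3 := by positivity
  have hX2 : X ≤ ε * ((B.card : ℝ) + ρ ^ 3) := by
    have : 2 * ε' * ((B.card : ℝ) + ρ ^ 3) ≤ ε * ((B.card : ℝ) + ρ ^ 3) :=
      mul_le_mul_of_nonneg_right (by linarith) hM0
    linarith
  -- (2) the separated charge ⇒ virial² ≤ K·#B·X ≤ 2Kε'·(#B + ρ³)² ≤ ε²·(#B + ρ³)²
  have hV2 : (S - T) ^ 2 ≤ (ε * ((B.card : ℝ) + ρ ^ 3)) ^ 2 := by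
    have hcardle : (B.card : ℝ) ≤ (B.card : ℝ) + ρ ^ 3 := by linarith [pow_pos hρ0 3]
    have hKB : K * (B.card : ℝ) ≤ K * ((B.card : ℝ) + ρ ^ 3) := mul_le_mul_of_nonneg_left hcardle hK0.le
    calc (S - T) ^ 2 ≤ K * (B.card : ℝ) * X := hV
      _ ≤ K * ((B.card : ℝ) + ρ ^ 3) * X := mul_le_mul_of_nonneg_right hKB hX0
      _ ≤ K * ((B.card : ℝ) + ρ ^ 3) * (2 * ε' * ((B.card : ℝ) + ρ ^ 3)) :=
          mul_le_mul_of_nonneg_left hX1 (mul_nonneg hK0.le hM0)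
      _ = (2 * K * ε') * ((B.card : ℝ) + ρ ^ 3) ^ 2 := by ring
      _ ≤ ε ^ 2 * ((B.card : ℝ) + ρ ^ 3) ^ 2 := mul_le_mul_of_nonneg_right hε'K (by positivity)
      _ = (ε * ((B.card : ℝ) + ρ ^ 3)) ^ 2 := by ring
  exact ⟨hX0, hX2, abs_le_of_sq_le_sq hV2 (mul_nonneg hε.le hM0)⟩

/-- **Local zero pressure on ground-state windows** (the virial component of `gsWindow_excess_virial`):
`|S₁₂(B(p,ρ)) − S₆(B(p,ρ))| ≤ ε·(#B(p,ρ) + ρ³)` for `ρ ≥ ρ₁(ε)`, every ground state, every centre. -/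
theorem gsWindowVirial_small : ∀ ε : ℝ, 0 < ε → ∃ ρ₁ : ℝ, ∀ ρ : ℝ, ρ₁ ≤ ρ →
    ∀ (N : ℕ) (y : Fin N → EuclideanSpace ℝ (Fin 3)), IsGroundState lennardJones y → ∀ p : EuclideanSpace ℝ (Fin 3),
      |(∑ i ∈ Finset.univ.filter (fun i : Fin N => dist (y i) p ≤ ρ),
            ∑ k ∈ (Finset.univ.filter (fun i : Fin N => dist (y i) p ≤ ρ)).erase i, (dist (y i) (y k))⁻¹ ^ 12) -
          ∑ i ∈ Finset.univ.filter (fun i : Fin N => dist (y i) p ≤ ρ),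
            ∑ k ∈ (Finset.univ.filter (fun i : Fin N => dist (y i) p ≤ ρ)).erase i, (dist (y i) (y k))⁻¹ ^ 6|
        ≤ ε * (((Finset.univ.filter (fun i : Fin N => dist (y i) p ≤ ρ)).card : ℝ) + ρ ^ 3) := by
  intro ε hε
  obtain ⟨ρ₁, h⟩ := gsWindow_excess_virial ε hε
  exact ⟨ρ₁, fun ρ hρ N y hGS p => (h ρ hρ N y hGS p).2.2⟩

/-- **Moment pinning, repulsive sum**: on large ground-state windows `|S₁₂(B) + 24·#B·e⋆| ≤ ε·(#B + ρ³)` —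
the repulsive lattice sum per particle is pinned to `−24·e⋆`. -/
theorem gsWindowTwelve_pinned : ∀ ε : ℝ, 0 < ε → ∃ ρ₁ : ℝ, ∀ ρ : ℝ, ρ₁ ≤ ρ →
    ∀ (N : ℕ) (y : Fin N → EuclideanSpace ℝ (Fin 3)), IsGroundState lennardJones y → ∀ p : EuclideanSpace ℝ (Fin 3),
      |(∑ i ∈ Finset.univ.filter (fun i : Fin N => dist (y i) p ≤ ρ),
            ∑ k ∈ (Finset.univ.filter (fun i : Fin N => dist (y i) p ≤ ρ)).erase i, (dist (y i) (y k))⁻¹ ^ 12) +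
          24 * (((Finset.univ.filter (fun i : Fin N => dist (y i) p ≤ ρ)).card : ℝ) *
            (⨅ Q : PeriodicConfiguration 3, Q.energyPerParticle lennardJones))|
        ≤ ε * (((Finset.univ.filter (fun i : Fin N => dist (y i) p ≤ ρ)).card : ℝ) + ρ ^ 3) := by
  intro ε hε
  obtain ⟨ρ₁, h⟩ := gsWindow_excess_virial (ε / 26) (by positivity)
  refine ⟨ρ₁, fun ρ hρ N y hGS p => ?_⟩
  obtain ⟨h0, h1, h2⟩ := h ρ hρ N y hGS p
  rw [half_sum_lennardJones_eq] at h0 h1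
  have := (pinned_of_excess_virial h0 h1 h2).1
  linarith [this]

/-- **Moment pinning, attractive sum**: on large ground-state windows `|S₆(B) + 24·#B·e⋆| ≤ ε·(#B + ρ³)` —
the attractive lattice sum per particle is pinned to `−24·e⋆` as well. -/
theorem gsWindowSix_pinned : ∀ ε : ℝ, 0 < ε → ∃ ρ₁ : ℝ, ∀ ρ : ℝ, ρ₁ ≤ ρ →
    ∀ (N : ℕ) (y : Fin N → EuclideanSpace ℝ (Fin 3)), IsGroundState lennardJones y → ∀ p : EuclideanSpace ℝ (Fin 3),
      |(∑ i ∈ Finset.univ.filter (fun i : Fin N => dist (y i) p ≤ ρ),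
            ∑ k ∈ (Finset.univ.filter (fun i : Fin N => dist (y i) p ≤ ρ)).erase i, (dist (y i) (y k))⁻¹ ^ 6) +
          24 * (((Finset.univ.filter (fun i : Fin N => dist (y i) p ≤ ρ)).card : ℝ) *
            (⨅ Q : PeriodicConfiguration 3, Q.energyPerParticle lennardJones))|
        ≤ ε * (((Finset.univ.filter (fun i : Fin N => dist (y i) p ≤ ρ)).card : ℝ) + ρ ^ 3) := by
  intro ε hε
  obtain ⟨ρ₁, h⟩ := gsWindow_excess_virial (ε / 25) (by positivity)
  refine ⟨ρ₁, fun ρ hρ N y hGS p => ?_⟩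
  obtain ⟨h0, h1, h2⟩ := h ρ hρ N y hGS p
  rw [half_sum_lennardJones_eq] at h0 h1
  have := (pinned_of_excess_virial h0 h1 h2).2
  linarith [this]

end Summit.AtomisticToContinuum.Crystallization.Theorems.ContactSaturationLadderDilationCharge
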